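import Mathlib
import Summits.ValiantsHypothesis.ValiantsHypothesis.Statement
import Summits.ValiantsHypothesis.ValiantsHypothesis.Theses.FreeSubtorus
import Summits.ValiantsHypothesis.ValiantsHypothesis.Theorems.FreeSubtorusConfusionCovering
import Summits.ValiantsHypothesis.ValiantsHypothesis.Theorems.FreeSubtorusConfusionCoveringDial
import Summits.ValiantsHypothesis.ValiantsHypothesis.Theorems.FreeSubtorusOrbitDimensionBoundStubGenericElementNoMinor
import Summits.ValiantsHypothesis.ValiantsHypothesis.Theorems.FreeSubtorusOrbitDimensionBoundStubGradedNormalForm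
import Summits.ValiantsHypothesis.ValiantsHypothesis.Theorems.FreeSubtorusOrbitDimensionBoundStubKernelCycle
import Summits.ValiantsHypothesis.ValiantsHypothesis.Cruxes.OrbitDimensionBound.Lines.NoMinorLadder

/-!
# Line `no_minor_covering` — skeleton for the rung `NoMinorCovering` (forward rung g5, crux dir
# `OrbitDimensionBound`, stmt-ValiantsHypothesis-16133, route `FreeSubtorus`)

Target: `NoMinor.NoMinorCovering` (`Lines/NoMinorLadder.lean`): for `n ≥ 3`, a `T_Λ`-equivariant (exact lifts)
affine determinantal representation of `per_n` of size `m`, `Λ` with `r` generators and NO INVARIANT PROPER MINOR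
(no indicator `(1_A ; 1_{σ A})`, `∅ ≠ A ⊊ [n]`, in `span_ℚ Λ`), has `C(n, ⌊n/2⌋) ≤ m · 2^r`.

Architecture = the landed engine of `Theorems.FreeSubtorusConfusionCovering*` (regularity → generic element → exact
lift → kernel eigenvalue → graded form → Leibniz extraction → class count → Odlyzko) with its ONE admissibility-dependent
step replaced.  The landed `stub_pathWeights` needs weights WITHOUT non-negative multiplicative relations and turns the
Leibniz data into an ACYCLIC unit flow, which is then a path (`exists_chain_of_flow`); for a non-admissible `Λ` such as
`𝟙` (the per-invariant torus `T'_1`) every permutation monomial is such a relation and the flow's divergence data is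
identically zero.  Here instead:

* `stub_genericElementNoMinor` (M) — a generic element `(d, e)` of `T_Λ` for ARBITRARY `Λ` (relations + exact
  separation, the Liouville construction of `exists_generic_weights`), whose weights `d_k e_{σ k}` have product `≠ 1`
  over every PROPER non-empty row set — this is where the class `NoInvariantMinor` enters (a product `= 1` is, by exact
  separation, an indicator character in `span_ℚ Λ`);
* `stub_gradedNormalForm` (M) — inside bases adapted to the generalised eigenspaces of the lift `(g, h)` (landed
  `exists_gradedForm`), the constant part of a REGULAR representation can be brought to `diag(0, 1, …, 1)` by
  weight-block row/column operations and a row permutation, keeping the grading (`x_p`-entries only between weights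
  `β_i = c_p α_j`, matched indices `β_j = α_j`), with the kernel column `j₀` of weight `α_{j₀} = γ₀`, all column
  weights non-zero, and every row weight a generalised eigenvalue of `g` — NEW relative to the landed graded form (which
  keeps the constant part arbitrary inside the weight blocks);
* `stub_kernelCycle` (L, load-bearing) — THE NEW COMBINATORIAL HEART: in graded normal form, substitute the weighted
  permutation matrix of `σ` and extract a Leibniz permutation `π` (landed `exists_perm_embedding_of_coeff_det_ne_zero`);
  the cycle of `π` through the kernel column reads a sub-matching `τ ⊆ σ`, every other non-trivial cycle of `π` reads a
  sub-matching whose weight product is `1`; if no proper non-empty sub-matching of `σ` has product `1`, the kernel cycle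
  reads ALL of `σ`, in some order `k_1, …, k_n`, and its `i`-th vertex has weight `γ₀ c_{k_1 σ k_1} ⋯ c_{k_i σ k_i}` —
  so `σ` is served at EVERY level `1 ≤ i ≤ n` (no flow, no acyclicity, no divergence bookkeeping).

Composition `NoMinorCovering_of` (kernel-checked, sorries only in the three stubs): steps (0), (2)–(4) are the landed
main proof verbatim; (5) = the two new stubs; (6) = the landed `stub_classCount` + Odlyzko
(`card_confusedClass_le_two_pow`, valid for every `Λ`). [cite: LandsbergRessayre2017, Thm. 2.8, §6]
[cite: Odlyzko1988, p. 127] [cite: Vonzurgathen1987, Thm. 3.1]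
-/

open Matrix MvPolynomial Finset
open Literature.Computability.AlgebraicComplexity LRPencil
open Summit.ValiantsHypothesis.ValiantsHypothesis.Theorems
open Summit.ValiantsHypothesis.ValiantsHypothesis.Theorems.FreeSubtorusConfusionCovering
open scoped Kronecker

set_option linter.dupNamespace false

noncomputable section

namespace Summit.ValiantsHypothesis.ValiantsHypothesis.Cruxes.OrbitDimensionBound.NoMinor

/-! ## The three registered stubs -/

/-- **Stub 1 (M): a generic element of `T_Λ` for arbitrary `Λ`, junk-free along permutations when `Λ` has no
invariant proper minor.**  There are `d, e ∈ (ℂˣ)ⁿ` with (i) the relations of `T_Λ`, (ii) exact separation — a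
character `χ` with `χ(d, e) = 1` has `N χ ∈ ℤΛ` for some `N ≠ 0` — and (iii) for every permutation `σ` and every
proper non-empty row set `M`, `∏_{k ∈ M} d_k e_{σ k} ≠ 1`.  ((i),(ii): the Liouville construction of the landed
`exists_generic_weights` / `stub_genericElement` without its row-sum hypothesis; (iii): a product `1` gives, by (ii),
`(1_M ; 1_{σ M}) ∈ span_ℚ Λ`, excluded by `NoInvariantMinor`.) [cite: LandsbergRessayre2017, §6] -/
theorem stub_genericElementNoMinor :
    ∀ (n r : ℕ) (Λ : Fin r → (Fin n ⊕ Fin n) → ℤ), NoInvariantMinor n r Λ →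
    ∃ d e : Fin n → ℂˣ,
      (∀ i, (∏ k, (d k) ^ (Λ i (Sum.inl k))) * (∏ l, (e l) ^ (Λ i (Sum.inr l))) = 1) ∧
      (∀ χ : (Fin n ⊕ Fin n) → ℤ,
        (∏ k, (d k) ^ (χ (Sum.inl k))) * (∏ l, (e l) ^ (χ (Sum.inr l))) = 1 →
        ∃ (N : ℤ) (a : Fin r → ℤ), N ≠ 0 ∧ N • χ = ∑ i, a i • Λ i) ∧
      (∀ (σ : Equiv.Perm (Fin n)) (M : Finset (Fin n)), M.Nonempty → M ≠ Finset.univ →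
        (∏ k ∈ M, ((d k : ℂ) * (e (σ k) : ℂ))) ≠ 1) := by
  -- rev (tenure g11, 2026-08-28, director-valiant R105; recipe val-lit-p4 g11): THEOREM p600558
  exact Summit.ValiantsHypothesis.ValiantsHypothesis.Theorems.FreeSubtorusOrbitDimensionBound.NoMinorCovering.stub_genericElementNoMinor

/-- **Stub 2 (M): graded NORMAL form.**  Let `A` be a regular affine representation of `per_n` (`n ≥ 3`), `c` weights,
`(g, h) ∈ GL_m²` an exact lift (`g A₀ = A₀ h`, `g A_p = c_p A_p h`) with `ker A₀ ⊆ E_h(γ₀)`.  Then for some invertible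
`P, Q`, weights `α, β : [m] → ℂ` and an index `j₀`, the matrix `A' = P A Q` has constant part EXACTLY
`diag(j ↦ [j ≠ j₀])`, matched indices carry equal weights (`β_j = α_j`, `j ≠ j₀`), an `x_p`-entry at `(i, j)` forces
`β_i = c_p α_j`, the kernel column has weight `α_{j₀} = γ₀`, all `α_j ≠ 0`, and every `β_i` is a generalised
eigenvalue of `g`.  (Landed `exists_gradedForm` + rank normal form inside each weight block + a row permutation; the
kernel line lies in `E_h(γ₀)`.) [cite: LandsbergRessayre2017, §6] -/
theorem stub_gradedNormalForm :
    ∀ (n m : ℕ) (A : Matrix (Fin m) (Fin m) (MvPolynomial (Fin n × Fin n) ℂ)) (c : Fin n × Fin n → ℂ)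
    (g h : GL (Fin m) ℂ) (γ₀ : ℂ),
    3 ≤ n →
    IsRegularDetRepr (perPoly (Fin n) ℂ) A →
    (g : Matrix (Fin m) (Fin m) ℂ) * constPart A = constPart A * (h : Matrix (Fin m) (Fin m) ℂ) →
    (∀ p : Fin n × Fin n, (g : Matrix (Fin m) (Fin m) ℂ) * coeffMat A p =
        c p • (coeffMat A p * (h : Matrix (Fin m) (Fin m) ℂ))) →
    LinearMap.ker (Matrix.toLin' (constPart A)) ≤
      Module.End.maxGenEigenspace (Matrix.toLin' (h : Matrix (Fin m) (Fin m) ℂ)) γ₀ →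
    ∃ (P Q : GL (Fin m) ℂ) (α β : Fin m → ℂ) (j₀ : Fin m),
      constPart ((P : Matrix (Fin m) (Fin m) ℂ).map C * A * (Q : Matrix (Fin m) (Fin m) ℂ).map C) =
        Matrix.diagonal (fun j => if j = j₀ then (0 : ℂ) else 1) ∧
      (∀ j, j ≠ j₀ → β j = α j) ∧
      (∀ (p : Fin n × Fin n) (i j : Fin m),
        coeffMat ((P : Matrix (Fin m) (Fin m) ℂ).map C * A * (Q : Matrix (Fin m) (Fin m) ℂ).map C) p i j ≠ 0 →
        β i = c p * α j) ∧
      α j₀ = γ₀ ∧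
      (∀ j, α j ≠ 0) ∧
      (∀ i, Module.End.maxGenEigenspace (Matrix.toLin' (g : Matrix (Fin m) (Fin m) ℂ)) (β i) ≠ ⊥) := by
  -- rev (tenure g11, 2026-08-28, director-valiant R105; recipe val-lit-p4 g11): THEOREM p606037 (+ prelim p605699)
  exact Summit.ValiantsHypothesis.ValiantsHypothesis.Theorems.FreeSubtorusOrbitDimensionBound.GradedNormalForm.stub_gradedNormalForm

/-- **Stub 3 (L, load-bearing): the kernel cycle reads the whole permutation.**  Let `A'` be affine with
`det A' = κ · per_n` (`κ ≠ 0`), in graded normal form: constant part `diag(j ↦ [j ≠ j₀])`, matched indices of equal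
weight, `x_p`-entries only from column weight `α_j` to row weight `β_i = c_p α_j`, non-zero weights, kernel column of
weight `α_{j₀} = γ₀`.  If `σ ∈ 𝔖_n` has NO proper non-empty row set `M` with `∏_{k ∈ M} c_{k σ k} = 1`, then for every
`1 ≤ i ≤ n` some `i`-set `I` of rows and some index `i'` have `β_{i'} = γ₀ ∏_{k ∈ I} c_{k σ k}`.  (Substitute the
`y`-weighted permutation matrix of `σ`, extract a Leibniz permutation `π` and variable assignment `τ` — landed
`exists_perm_embedding_of_coeff_det_ne_zero` —; columns off `range τ` are fixed by `π`; the `π`-cycle through `j₀`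
reads rows `k_1, …, k_ℓ` with `α_{π^s j₀} = γ₀ c_{k_1 σ k_1} ⋯ c_{k_s σ k_s}`; every other cycle of `π`, and every fixed
column in `range τ`, reads a non-empty proper row set of weight product `1`; hence `ℓ = n`.) [new; folklore tools] -/
theorem stub_kernelCycle :
    ∀ (n m : ℕ) (A' : Matrix (Fin m) (Fin m) (MvPolynomial (Fin n × Fin n) ℂ)) (c : Fin n × Fin n → ℂ)
    (α β : Fin m → ℂ) (j₀ : Fin m) (γ₀ κ : ℂ),
    κ ≠ 0 → (∀ p, c p ≠ 0) → (∀ j, α j ≠ 0) →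
    (∀ i j, (A' i j).totalDegree ≤ 1) →
    A'.det = C κ * perPoly (Fin n) ℂ →
    constPart A' = Matrix.diagonal (fun j => if j = j₀ then (0 : ℂ) else 1) →
    (∀ j, j ≠ j₀ → β j = α j) →
    (∀ (p : Fin n × Fin n) (i j : Fin m), coeffMat A' p i j ≠ 0 → β i = c p * α j) →
    α j₀ = γ₀ →
    ∀ σ : Equiv.Perm (Fin n),
    (∀ M : Finset (Fin n), M.Nonempty → M ≠ Finset.univ → (∏ k ∈ M, c (k, σ k)) ≠ 1) →
    ∀ i : ℕ, 1 ≤ i → i ≤ n →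
      ∃ I : Finset (Fin n), I.card = i ∧ ∃ i' : Fin m, β i' = γ₀ * ∏ k ∈ I, c (k, σ k) := by
  -- rev (tenure g11, 2026-08-28, director-valiant R105; recipe val-lit-p4 g11): THEOREM p606345 (+ prelim p606186)
  exact Summit.ValiantsHypothesis.ValiantsHypothesis.Theorems.FreeSubtorusOrbitDimensionBound.KernelCycle.stub_kernelCycle

/-! ## The composition (no `sorry` below this line) -/

/-- **`NoMinorCovering_of`: the three stubs imply the rung `NoMinorCovering`, by name.**  Steps (0), (2)–(4) are the
landed proof of `confusionCovering` verbatim; (1) = stub 1; (5) = stubs 2–3; (6) = landed `stub_classCount` + Odlyzko.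
[cite: LandsbergRessayre2017, Thm. 2.8, §6] [cite: Odlyzko1988, p. 127] [cite: Vonzurgathen1987, Thm. 3.1] -/
theorem NoMinorCovering_of
    (h₁ : ∀ (n r : ℕ) (Λ : Fin r → (Fin n ⊕ Fin n) → ℤ), NoInvariantMinor n r Λ →
      ∃ d e : Fin n → ℂˣ,
        (∀ i, (∏ k, (d k) ^ (Λ i (Sum.inl k))) * (∏ l, (e l) ^ (Λ i (Sum.inr l))) = 1) ∧
        (∀ χ : (Fin n ⊕ Fin n) → ℤ,
          (∏ k, (d k) ^ (χ (Sum.inl k))) * (∏ l, (e l) ^ (χ (Sum.inr l))) = 1 →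
          ∃ (N : ℤ) (a : Fin r → ℤ), N ≠ 0 ∧ N • χ = ∑ i, a i • Λ i) ∧
        (∀ (σ : Equiv.Perm (Fin n)) (M : Finset (Fin n)), M.Nonempty → M ≠ Finset.univ →
          (∏ k ∈ M, ((d k : ℂ) * (e (σ k) : ℂ))) ≠ 1))
    (h₂ : ∀ (n m : ℕ) (A : Matrix (Fin m) (Fin m) (MvPolynomial (Fin n × Fin n) ℂ)) (c : Fin n × Fin n → ℂ)
      (g h : GL (Fin m) ℂ) (γ₀ : ℂ),
      3 ≤ n →
      IsRegularDetRepr (perPoly (Fin n) ℂ) A →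
      (g : Matrix (Fin m) (Fin m) ℂ) * constPart A = constPart A * (h : Matrix (Fin m) (Fin m) ℂ) →
      (∀ p : Fin n × Fin n, (g : Matrix (Fin m) (Fin m) ℂ) * coeffMat A p =
          c p • (coeffMat A p * (h : Matrix (Fin m) (Fin m) ℂ))) →
      LinearMap.ker (Matrix.toLin' (constPart A)) ≤
        Module.End.maxGenEigenspace (Matrix.toLin' (h : Matrix (Fin m) (Fin m) ℂ)) γ₀ →
      ∃ (P Q : GL (Fin m) ℂ) (α β : Fin m → ℂ) (j₀ : Fin m),
        constPart ((P : Matrix (Fin m) (Fin m) ℂ).map C * A * (Q : Matrix (Fin m) (Fin m) ℂ).map C) =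
          Matrix.diagonal (fun j => if j = j₀ then (0 : ℂ) else 1) ∧
        (∀ j, j ≠ j₀ → β j = α j) ∧
        (∀ (p : Fin n × Fin n) (i j : Fin m),
          coeffMat ((P : Matrix (Fin m) (Fin m) ℂ).map C * A * (Q : Matrix (Fin m) (Fin m) ℂ).map C) p i j ≠ 0 →
          β i = c p * α j) ∧
        α j₀ = γ₀ ∧
        (∀ j, α j ≠ 0) ∧
        (∀ i, Module.End.maxGenEigenspace (Matrix.toLin' (g : Matrix (Fin m) (Fin m) ℂ)) (β i) ≠ ⊥))
    (h₃ : ∀ (n m : ℕ) (A' : Matrix (Fin m) (Fin m) (MvPolynomial (Fin n × Fin n) ℂ)) (c : Fin n × Fin n → ℂ)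
      (α β : Fin m → ℂ) (j₀ : Fin m) (γ₀ κ : ℂ),
      κ ≠ 0 → (∀ p, c p ≠ 0) → (∀ j, α j ≠ 0) →
      (∀ i j, (A' i j).totalDegree ≤ 1) →
      A'.det = C κ * perPoly (Fin n) ℂ →
      constPart A' = Matrix.diagonal (fun j => if j = j₀ then (0 : ℂ) else 1) →
      (∀ j, j ≠ j₀ → β j = α j) →
      (∀ (p : Fin n × Fin n) (i j : Fin m), coeffMat A' p i j ≠ 0 → β i = c p * α j) →
      α j₀ = γ₀ →
      ∀ σ : Equiv.Perm (Fin n),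
      (∀ M : Finset (Fin n), M.Nonempty → M ≠ Finset.univ → (∏ k ∈ M, c (k, σ k)) ≠ 1) →
      ∀ i : ℕ, 1 ≤ i → i ≤ n →
        ∃ I : Finset (Fin n), I.card = i ∧ ∃ i' : Fin m, β i' = γ₀ * ∏ k ∈ I, c (k, σ k)) :
    NoMinorCovering := by
  intro n hn m r Λ B hΛ hB
  classical
  -- (0) the affine data and regularity (von zur Gathen 1987, Thm. 3.1, proved in the tree)
  have haff : ∀ i j, (B i j).totalDegree ≤ 1 := hB.1.1
  have hdet : B.det = perPoly (Fin n) ℂ := hB.1.2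
  have hreg : IsRegularDetRepr (perPoly (Fin n) ℂ) B :=
    hB.isRegular_perPoly vonzurGathen1987_perm_detRepr_rank_holds hn
  -- (1) a generic element `(d, e)` of the subtorus, junk-free along permutations (stub 1; no admissibility)
  obtain ⟨d, e, hrel, hsep, hjunk⟩ := h₁ n r Λ hΛ
  have hc0 : ∀ p : Fin n × Fin n, ((fun p : Fin n × Fin n => (d p.1 : ℂ) * (e p.2 : ℂ)) p) ≠ 0 :=
    fun p => mul_ne_zero (d p.1).ne_zero (e p.2).ne_zero
  have hd0 : ∀ k, ((fun k => (d k : ℂ)) k) ≠ 0 := fun k => (d k).ne_zero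
  have he0 : ∀ l, ((fun l => (e l : ℂ)) l) ≠ 0 := fun l => (e l).ne_zero
  -- (2) the torus element `x_{kl} ↦ d_k e_l x_{kl}` = `diag(d) ⊗ diag(e) ∈ GL(n²)`; it is a generator of `T_Λ`
  let γ : GL (Fin n × Fin n) ℂ :=
    Matrix.GeneralLinearGroup.kronecker (diagUnit ℂ (fun k => (d k : ℂ)) hd0) (diagUnit ℂ (fun l => (e l : ℂ)) he0)
  have hγcoe : (γ : Matrix (Fin n × Fin n) (Fin n × Fin n) ℂ) =
      Matrix.diagonal (fun p : Fin n × Fin n => (d p.1 : ℂ) * (e p.2 : ℂ)) := by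
    show Matrix.diagonal _ ⊗ₖ Matrix.diagonal _ = _
    exact Matrix.diagonal_kronecker_diagonal _ _
  have hγmem : γ ∈ Subgroup.closure {γ : Matrix.GeneralLinearGroup (Fin n × Fin n) ℂ |
      ∃ d e : Fin n → ℂˣ, (∀ i, (∏ k, (d k) ^ (Λ i (Sum.inl k))) * (∏ l, (e l) ^ (Λ i (Sum.inr l))) = 1) ∧
        (γ : Matrix (Fin n × Fin n) (Fin n × Fin n) ℂ) =
          Matrix.diagonal (fun p => (d p.1 : ℂ) * (e p.2 : ℂ))} :=
    Subgroup.subset_closure ⟨d, e, hrel, hγcoe⟩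
  -- (3) its exact lift `(g, h)`: `g B₀ = B₀ h` and `g B_p = d_{p.1} e_{p.2} B_p h`
  obtain ⟨g, h, hgh, hΛ0⟩ := hB.exists_lift_stabilising hγmem
  have hAv : ∀ p : Fin n × Fin n, (g : Matrix (Fin m) (Fin m) ℂ) * coeffMat B p =
      ((d p.1 : ℂ) * (e p.2 : ℂ)) • (coeffMat B p * (h : Matrix (Fin m) (Fin m) ℂ)) := by
    intro p
    have e1 : coeffMat (Matrix.linSubstEntries γ B) p =
        coeffMat ((g : Matrix (Fin m) (Fin m) ℂ).map C * B *
          ((h⁻¹ : GL (Fin m) ℂ) : Matrix (Fin m) (Fin m) ℂ).map C) p := by rw [hgh]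
    rw [coeffMat_linSubstEntries _ _ haff, hγcoe, ProjectionStabilityOptStep.TwoSidedTorusRestricted.sum_diagonal_smul,
      coeffMat_C_mul_mul_C] at e1
    rw [mul_eq_of_eq_mul_mul_inv e1, Matrix.smul_mul]
  -- (4) regularity: the kernel of `B₀` is a line, on which `h` has an eigenvalue `γ₀ ≠ 0`
  set Λm : Matrix (Fin m) (Fin m) ℂ := constPart B with hΛm
  have hm : 1 ≤ m := by
    rcases Nat.eq_zero_or_pos m with h0 | h0
    · subst h0
      exfalso
      have h3 : B.det = 1 := Matrix.det_isEmpty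
      have h4 := congrArg constantCoeff hdet
      rw [h3, constantCoeff_perPoly ℂ (by omega : 1 ≤ n), map_one] at h4
      exact one_ne_zero h4
    · exact h0
  have hK : Module.finrank ℂ (LinearMap.ker (Matrix.toLin' Λm)) = 1 := by
    have h1 := LinearMap.finrank_range_add_finrank_ker (Matrix.toLin' Λm)
    rw [Module.finrank_fin_fun] at h1
    have h2 : Module.finrank ℂ (LinearMap.range (Matrix.toLin' Λm)) = m - 1 := by
      rw [Matrix.toLin'_apply']; exact hreg.2
    omega
  let L : Lift (Matrix.toLin' Λm) (fun _ _ : Fin n => Matrix.toLin' (0 : Matrix (Fin m) (Fin m) ℂ)) 1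
      (fun _ => (1 : ℂ)) :=
    liftOfMatrices Λm (fun _ _ => 0) 1 _ (fun _ => one_ne_zero) g h hΛ0 (fun _ _ => by simp)
  obtain ⟨γ₀, hγ₀, hker⟩ := exists_eigenvalue_of_finrank_ker_eq_one _ L.C L.map_ker_eq hK
  have hker' : LinearMap.ker (Matrix.toLin' (constPart B)) ≤
      Module.End.maxGenEigenspace (Matrix.toLin' (h : Matrix (Fin m) (Fin m) ℂ)) γ₀ := hker
  -- (5a) graded NORMAL form (stub 2)
  obtain ⟨P, Q, α, β, j₀, hKform, hmatch, hcoef, hαj₀, hα0, hβeig⟩ :=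
    h₂ n m B (fun p : Fin n × Fin n => (d p.1 : ℂ) * (e p.2 : ℂ)) g h γ₀ hn hreg hΛ0 hAv hker'
  set A' := (P : Matrix (Fin m) (Fin m) ℂ).map C * B * (Q : Matrix (Fin m) (Fin m) ℂ).map C with hA'
  have haff' : ∀ i j, (A' i j).totalDegree ≤ 1 := totalDegree_C_mul_mul_C_le_one _ _ B haff
  have hdet' : A'.det = C ((P : Matrix (Fin m) (Fin m) ℂ).det * (Q : Matrix (Fin m) (Fin m) ℂ).det) *
      perPoly (Fin n) ℂ := by
    rw [hA', Matrix.det_mul, Matrix.det_mul, ← RingHom.mapMatrix_apply, ← RingHom.mapMatrix_apply,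
      ← RingHom.map_det, ← RingHom.map_det, hdet, map_mul]
    ring
  have hκ : (P : Matrix (Fin m) (Fin m) ℂ).det * (Q : Matrix (Fin m) (Fin m) ℂ).det ≠ 0 :=
    mul_ne_zero (Matrix.GeneralLinearGroup.det_ne_zero P) (Matrix.GeneralLinearGroup.det_ne_zero Q)
  -- (5b) the kernel cycle (stub 3): every permutation is served at the middle level by a weight of `g`
  have hserved : ∀ σ : Equiv.Perm (Fin n), ∃ I : Finset (Fin n), I.card = n / 2 ∧
      Module.End.maxGenEigenspace (Matrix.toLin' (g : Matrix (Fin m) (Fin m) ℂ))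
        (γ₀ * ∏ k ∈ I, ((d k : ℂ) * (e (σ k) : ℂ))) ≠ ⊥ := by
    intro σ
    obtain ⟨I, hI, i', hi'⟩ := h₃ n m A' (fun p : Fin n × Fin n => (d p.1 : ℂ) * (e p.2 : ℂ)) α β j₀ γ₀ _
      hκ hc0 hα0 haff' hdet' hKform hmatch hcoef hαj₀ σ (hjunk σ) (n / 2) (by omega) (Nat.div_le_self n 2)
    refine ⟨I, hI, ?_⟩
    have h1 := hβeig i'
    rwa [hi'] at h1
  -- (6) the class count at the middle level (landed), then Odlyzko's bound `≤ 2^r` on a confusion class (landed)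
  obtain ⟨q, -, -, hq⟩ := stub_classCount n m r Λ d e γ₀ (g : Matrix (Fin m) (Fin m) ℂ) hγ₀ hsep hserved
  exact hq.trans (Nat.mul_le_mul_left m (card_confusedClass_le_two_pow n r (n / 2) Λ q))

/-- The rung's shadow follows too (for the forward bookkeeping). [folklore] -/
theorem NoMinorShadow_of_stubs
    (h : NoMinorCovering) : NoMinorShadow := noMinorShadow_of_noMinorCovering h

/-- **THE SKELETON, NOW SORRY-FREE: the numeric rung `NoMinorCovering` from the three registered stubs, all of
which are landed Theorems since 2026-08-28 (p600558 / p606037 / p606345; wired by tenure g11 per director R105).**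
Honest framing: a forward RUNG of the ladder `NoMinorLadder`, not the crux `OrbitDimensionBound`; `floor_of_stubs` /
`vh_of_orbitNoMinorBound_of_stubs` stay conditional on `OrbitNoMinorBound`; route `FreeSubtorus` and VP ≠ VNP OPEN. -/
theorem NoMinorCovering_proof : NoMinorCovering :=
  NoMinorCovering_of stub_genericElementNoMinor stub_gradedNormalForm stub_kernelCycle

/-- **The rung declaration `NoMinorShadow` (kernel `rung_decl`) modulo the three registered stubs.** -/
theorem NoMinorShadow_proof : NoMinorShadow :=
  NoMinorShadow_of_stubs NoMinorCovering_proof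

/-- For the record: the stubs re-prove the floor `SubtorusCovering`. -/
theorem floor_of_stubs :
    Summit.ValiantsHypothesis.ValiantsHypothesis.Theses.FreeSubtorus.SubtorusCovering :=
  subtorusCovering_of_noMinorCovering NoMinorCovering_proof

/-- For the record: with the relaxed symmetrisation target `OrbitNoMinorBound` the stubs decide the summit. -/
theorem vh_of_orbitNoMinorBound_of_stubs (h₀ : OrbitNoMinorBound) : _root_.ValiantsHypothesis :=
  closes_noMinor h₀ NoMinorCovering_proof

end Summit.ValiantsHypothesis.ValiantsHypothesis.Cruxes.OrbitDimensionBound.NoMinor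

end
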